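import Literature.AlgebraicGeometry.HodgeTheory.ComplexGysinCorrespondence

/-!
# Stub `stub_topCorrAction` (T3) of line `purity-sorted-hecke-envelope` / `HeckeGraphChow`
# (crux `EndoscopicMiddleDegree.OrthogonalEnveloped`, stmt-HodgeConjecture-14300):
# the action of the Poincaré dual of a pushed-forward class is push–pull

Registered skeleton: `Cruxes/OrthogonalEnveloped/HeckeGraphChow.lean`; this is the file
`Theorems/EndoscopicMiddleDegreeOrthogonalEnvelopedTopCorrAction.lean` of the summit
(`--supports stmt-HodgeConjecture-14300`).

WHAT IS PROVED. For an orientation family `μ` with Poincaré duality, `X` smooth projective over `ℂ`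
of dimension `d = 2(m+1)`, `Y = X ⊗ X`, ANY topological space `L` with a continuous map
`F : L → Y(ℂ)`, a class `θ ∈ H_{2d}(L; ℂ)` and `γ ∈ H^{2d}(Y(ℂ); ℂ)` Poincaré dual to `F_* θ`
(`γ ⌢ [Y(ℂ)] = F_* θ`), the crux's correspondence action `P_γ = corrAction μ hX hX rfl γ`,
`P_γ β = pr₁₊(pr₂^* β ∪ γ)` (`pr₁₊ = complexGysin μ = D_X⁻¹ ∘ pr₁(ℂ)_* ∘ D_Y`), satisfies
`P_γ β ⌢ [X(ℂ)] = (pr₁(ℂ) ∘ F)_* ((pr₂(ℂ) ∘ F)^* β ⌢ θ)` — Fulton's `α_*(β) = p_{1*}(p_2^* β · α)`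
for the topological "cycle" `F_* θ`, read through Poincaré duality. Cap-product calculus only:
`P_γ β ⌢ [X] = pr₁(ℂ)_*((pr₂^*β ∪ γ) ⌢ [Y])` (`capProduct_complexGysin`),
`(pr₂^*β ∪ γ) ⌢ [Y] = (γ ∪ pr₂^*β) ⌢ [Y]` (graded commutativity, both degrees even)
`= pr₂^*β ⌢ (γ ⌢ [Y]) = pr₂^*β ⌢ F_*θ` (`cupProduct_capProduct`) `= F_*(F^* pr₂^*β ⌢ θ)`
(`capProduct_map`), and functoriality of `f^*`, `f_*`.

## References

* [Fulton1998] W. Fulton, Intersection Theory, 2nd ed., Springer 1998, §16.1 Prop. 16.1.1.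
* [FultonYoungTableaux1997] W. Fulton, Young Tableaux, CUP 1997, App. B §B.1 (5).
* [HatcherAT2002] A. Hatcher, Algebraic Topology, CUP 2002, §3.2 Thm. 3.11, §3.3 p. 241.
-/

noncomputable section

-- The crux-workfile namespace `Summit.<P>.<Sub>.Cruxes.…` repeats `HodgeConjecture` (single-conjunct summit).
set_option linter.dupNamespace false

namespace Summit.HodgeConjecture.HodgeConjecture.Cruxes.OrthogonalEnveloped.HeckeGraphChow

open CategoryTheory MonoidalCategory CartesianMonoidalCategory
open Literature.AlgebraicGeometry.Motives (SchemeOver ComplexPoints IsSmoothProjective AlgPoints)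
open Literature.AlgebraicGeometry.Motives (IsSmoothProjective.tensor_holds)
open Literature.AlgebraicGeometry.HodgeTheory
open Literature.AlgebraicTopology.SingularHomology

/-! ## Degree bookkeeping -/

/-- `2(m+1) + 2(m+1) = 2·2(m+1)` (private copy of the skeleton's degree lemma; the tree's
`…Negative.EnvelopeOfAlgebraic.two_add_two` has the same statement — any proof serves, by proof
irrelevance). [folklore] -/
private theorem two_add_two (m : ℕ) : 2 * (m + 1) + 2 * (m + 1) = 2 * (2 * (m + 1)) := by ring

/-- `2·2(m+1) + 2·2(m+1) = 2(2(m+1) + 2(m+1))`: the degree of the Hecke graph class as a codegree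
of the fundamental class of `(X ⊗ X)(ℂ)` (private copy of the skeleton's degree lemma). [folklore] -/
private theorem four_add_four (m : ℕ) :
    2 * (2 * (m + 1)) + 2 * (2 * (m + 1)) = 2 * (2 * (m + 1) + 2 * (m + 1)) := by ring

/-! ## The push–pull computation -/

/-- **`(pr₂^* β ∪ γ) ⌢ [Y] = F_*(F^* pr₂^* β ⌢ θ)` when `γ ⌢ [Y] = F_* θ`** (any space `Y`, any
homology class `[Y]`; degrees `d = 2(m+1)`, `2d`): graded commutativity in even degrees
(`cupProduct_gradedComm_holds`, sign `(-1)^{d·2d} = 1`), `(γ ∪ b) ⌢ c = b ⌢ (γ ⌢ c)`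
(`cupProduct_capProduct`) and the projection formula `F_*(F^* b ⌢ θ) = b ⌢ F_* θ` (`capProduct_map`).
[cite: HatcherAT2002, §3.2 Thm. 3.11 and §3.3 p. 241] -/
theorem capProduct_cupProduct_eq_map_of_capProduct_eq (m : ℕ) {Y L : Type} [TopologicalSpace Y]
    [TopologicalSpace L] (F : C(L, Y)) (θ : singularHomology ℂ ℂ L (2 * (2 * (m + 1))))
    (γ : singularCohomology ℂ ℂ Y (2 * (2 * (m + 1))))
    (c : singularHomology ℂ ℂ Y (2 * (2 * (m + 1) + 2 * (m + 1))))
    (hγ : capProduct (four_add_four m) γ c = singularHomology.map ℂ ℂ F (2 * (2 * (m + 1))) θ)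
    (ha : 2 * (m + 1) + 2 * (2 * (m + 1)) + 2 * (m + 1) = 2 * (2 * (m + 1) + 2 * (m + 1)))
    (b : singularCohomology ℂ ℂ Y (2 * (m + 1))) :
    capProduct ha
        (cupProduct (rfl : 2 * (m + 1) + 2 * (2 * (m + 1)) = 2 * (m + 1) + 2 * (2 * (m + 1))) b γ) c =
      singularHomology.map ℂ ℂ F (2 * (m + 1))
        (capProduct (two_add_two m) (singularCohomology.map ℂ ℂ F (2 * (m + 1)) b) θ) := by
  have hS : 2 * (2 * (m + 1)) + 2 * (m + 1) = 2 * (m + 1) + 2 * (2 * (m + 1)) := by ring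
  rw [cupProduct_gradedComm_holds ℂ Y rfl hS b γ,
    show ((-1 : ℂ) ^ (2 * (m + 1) * (2 * (2 * (m + 1))))) = 1 by
      rw [show 2 * (m + 1) * (2 * (2 * (m + 1))) = 2 * ((m + 1) * (2 * (2 * (m + 1)))) by ring,
        pow_mul, neg_one_sq, one_pow],
    one_smul, cupProduct_capProduct hS ha (two_add_two m) (four_add_four m), hγ, capProduct_map]

/-! ## The registered stub (signature must stay BYTE-IDENTICAL) -/

/-- **Stub T3 — the action of the Poincaré dual of a pushed-forward class is push–pull (KNOWN:
Fulton §16.1 Prop. 16.1.1 read topologically; M–L).** For `μ` with Poincaré duality, `X` smooth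
projective of dimension `2(m+1)`, ANY space `L` with a continuous `F : L → (X ⊗ X)(ℂ)`, a class
`θ ∈ H_{4(m+1)}(L; ℂ)` and `γ ∈ H^{4(m+1)}((X ⊗ X)(ℂ); ℂ)` with `γ ⌢ [(X ⊗ X)(ℂ)] = F_* θ`: for every
`β`, `P_γ β ⌢ [X(ℂ)] = (pr₁ ∘ F)_*((pr₂ ∘ F)^* β ⌢ θ)`, where `P_γ = corrAction μ hX hX rfl γ` is the
crux's `pr₁₊(pr₂^* β ∪ γ)` (`(pr₂^*β ∪ γ) ⌢ [Y] = pr₂^*β ⌢ (γ ⌢ [Y])` by graded commutativity and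
`cupProduct_capProduct`, `= F_*(F^*pr₂^*β ⌢ θ)` by `capProduct_map`, and `pr₁₊ = D_X⁻¹ pr₁_* D_Y`).
[cite: Fulton1998, §16.1 Prop. 16.1.1] [cite: HatcherAT2002, §3.3 p. 241] -/
theorem stub_topCorrAction :
    ∀ (μ : OrientationFamily), μ.HasPoincareDuality →
      ∀ (m : ℕ) (X : SchemeOver ℂ) (hX : IsSmoothProjective (2 * (m + 1)) X)
        (L : Type) [TopologicalSpace L] (F : C(L, ComplexPoints (X ⊗ X)))
        (θ : singularHomology ℂ ℂ L (2 * (2 * (m + 1))))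
        (γ : complexBetti (X ⊗ X) (2 * (2 * (m + 1)))),
        capProduct (four_add_four m) γ (μ (IsSmoothProjective.tensor_holds hX hX)).fundamentalClass =
          singularHomology.map ℂ ℂ F (2 * (2 * (m + 1))) θ →
        ∀ β : complexBetti X (2 * (m + 1)),
          capProduct (two_add_two m)
              (corrAction μ hX hX
                (rfl : 2 * (m + 1) + 2 * (2 * (m + 1)) = 2 * (m + 1) + 2 * (2 * (m + 1))) γ β)
              (μ hX).fundamentalClass =
            singularHomology.map ℂ ℂ ((AlgPoints.mapContinuous (L := ℂ) (fst X X)).comp F)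
              (2 * (m + 1))
              (capProduct (two_add_two m)
                (singularCohomology.map ℂ ℂ ((AlgPoints.mapContinuous (L := ℂ) (snd X X)).comp F)
                  (2 * (m + 1)) β) θ) := by
  intro μ hμ m X hX L _ F θ γ hγ β
  rw [corrAction_apply, capProduct_complexGysin hμ (IsSmoothProjective.tensor_holds hX hX) hX (fst X X) _
      (show 2 * (m + 1) + 2 * (2 * (m + 1)) + 2 * (m + 1) = 2 * (2 * (m + 1) + 2 * (m + 1)) by ring)
      (two_add_two m),
    capProduct_cupProduct_eq_map_of_capProduct_eq m F θ γ _ hγ, singularCohomology.map_comp,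
    ModuleCat.comp_apply, singularHomology.map_comp, ModuleCat.comp_apply]

end Summit.HodgeConjecture.HodgeConjecture.Cruxes.OrthogonalEnveloped.HeckeGraphChow

end
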